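import Summits.QuantumFields.YangMills.Theorems.FluctuationComparisonRegPrIntLOrganTangentFibreMeanVersionMW
import Summits.QuantumFields.YangMills.Theorems.FluctuationComparisonRegPrIntLOrganTangentAPackageDescendTo
import Literature.MathematicalPhysics.QuantumFieldTheory.Balaban1983to89.BalabanAdmissibleClassParams
import Literature.MathematicalPhysics.QuantumFieldTheory.Balaban1983to89.T4AveragingDisintegration
import Literature.MathematicalPhysics.QuantumFieldTheory.Balaban1983to89.T4CubeChartExp
import HarnessLib

/-!
# LEAD DRAFT TEXT (w3 g25) — «SPREAD-FIBRE-LAW-H» = SPREAD-TRANSPORT-H ∧ FIBRE-LAW-H with ONE shared fibred chart (V18 LIN KNIT SPEC §2–§3, §6.1), ELABORATION CHECK ONLY.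
# A PROPOSAL for ideator g28's pen (`FibreLawH.lean` / `SpreadTransportH.lean`); NOT a row of record; no registry / `Lines` byte.

SHAPE: O1ᵘ-H v2's frame VERBATIM through block ⑧ (NO seed clause — the row is about the averaging map, the window geometry and the REFERENCE tower only),
then uniform constants `rc Ncol Nrow NY CJ Nρ ND κ′` + a floor profile `ηin` (O1ᵘ-H's `δ` clauses verbatim), `j₀ ≤ j₁`, then per stride `∀ j ≥ j₁, ∀ (hjTs : j + 1 ≤ Ts)`:
`∃` ONE fibred chart `(Z, τ, Φ, J, S)` of `descendTo F ℰp j Ts` in ✓(L15-MW)'s letters (measurability · `MW ⊆ S` · `havgΦ` · `hmap` · (C1′) for every `z` · `J ≤ CJ` · (C3)-MW)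
TOGETHER WITH (i) DISPLACEMENT data `E, Corr` in ✓BRICK 2a's `hE`/`hCorr` shape at `act := update-move`, caps `√3·(‖a.2‖∕(θBal_{Ts}∕4)) ≤ rA∕2` (base) / `≤ rA∕2` (corr),
TWO-TIER grid windows (`PlaqSmall (23∕25·θBal_{Ts})` whenever `Φ(V,z) ∈ S`; `PlaqSmall (θBal_{Ts}∕4)` whenever `Φ(V,z)` is `θBal_{Ts}∕8`-deep — §6.1 zones), COLUMN letters
`Xl, Yl` (2a §3 shape) with RM-PB masses `Ncol, Nrow, NY` over a cross-level distance `dX` + its triangle; (ii) FIBRE-LAW letters w.r.t. the normalised weight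
`ŵ(V,z) := χ_{j,Ts}(Φ(V,z))·ρ′_{Ts}(Φ(V,z))·J(V,z) ∕ Z(V)` ((L19)/(L20)'s `χ` spelling): (χ) RN-variation `L²(ŵ_V)` letters `ρ₁, ρ₂` in ✓BRICK 3's factor shapes, κ-summable
(`Nρ`); (κ) per-fine-plaquette truncated-correlation decay against the weights' second variation (BRICK 3 §3′ slot) with per-plaquette weights `Dp`, a cross-level distance `dP`,
decay rate `κ′ > κ` and mass `ND`; (τ) quarter-window TAIL mass `≤ ηin Ts` (§6.1 zone II/III bookkeeping).  OPEN DESIGN POINTS for g28: the normalisation inside `Dp`/`ND`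
(instrument FL-20′/FL-21 currency), whether (χ)'s three `L²` rows are the right split, the two-tier windows vs fix (a′) of TN-WINDOW-β, binder order (here: constants → towers
→ stride → chart), and whether SPREAD-TRANSPORT-H should be split off as a tower-free kinematic row (it does not use `ρ, ρ′`; kept joint here only so the chart is shared).
HONEST: typing draft; nothing of Bałaban's asserted; whether the runs admit such a chart/fibre law is print's claim ([Balaban1985Variational] Thm 1/Prop 9, lit `B11`;
[Balaban1987RG1] Thm 1/Thm 3/(0.22)/(0.30), lit `B12`), not formalised; LINᵘ-H/JVARᵘ-H/O1ᵘ-H v2/S1aᴴ/26243/S2α′/S2β OPEN; 20520/`YM3TorusSU2` NOT proved; registry №36 +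
`Lines/runpair_organ.lean` v18 untouched; R3 = SU(2) YM₃ on T³ — NOT d = 4, NOT infinite volume, NOT a mass gap, NOT Clay.
-/

set_option autoImplicit false

noncomputable section

namespace Summit.QuantumFields.YangMills.Cruxes.FluctuationComparisonRegPrIntL.SpreadFibreLawHDraft

open MeasureTheory Filter Topology Function
open scoped ENNReal NNReal BigOperators
open Literature.MathematicalPhysics.QuantumFieldTheory.Balaban1983to89 T3ContinuumYM3Torus T3NestedUnitLaws
  T3UnitLawDensityEML T4Continuum BalabanUVClass T3UnitScaleTilt T3LevelShift T3TiltDescent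
open T4CubeChartExp (expPt)

/-- LEAD DRAFT «SPREAD-FIBRE-LAW-H» (see the module docstring): SPREAD-TRANSPORT-H ∧ FIBRE-LAW-H with a shared chart. A PROPOSAL, not a row of record. XL; NOT PRINTED as
a theorem — [Balaban1985Variational] Thm 1 p.279 / Prop 9 p.309 and [Balaban1987RG1] Thm 1 / Thm 3 / (0.22) / (0.30) are the results it would be assembled from. -/
def SpreadFibreLawH : Prop :=
  ∃ γ₁ : ℝ, 0 < γ₁ ∧ ∀ (F : T3Family) (γ : ℝ), 0 < γ → γ ≤ γ₁ → ∀ (b₀ p₀ : ℝ) (j₀ : ℕ) (prm : ℕ → ClassParams) (η : ℕ → ℝ) (rA : ℝ) (Bρ : ℕ → ℝ), 0 < b₀ → 0 < p₀ → AdmissibleClassParams F γ b₀ p₀ prm → (∀ j, 0 ≤ η j) → Summable η → Summable (fun i => ∑' k, η (k + i)) → Tendsto (fun j => (∑' k, η (k + j)) * ((1 + 2 * ((F.L : ℝ) ^ j / γ) * (Fintype.card (Plaq (F.P j) 0) : ℝ)) * (Fintype.card (PBond (F.P j) 0) : ℝ) ^ 2)) atTop (𝓝 0) → 0 < rA → ∃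 κ₀ : ℝ, 0 < κ₀ ∧ ∀ (κ : ℝ), 0 < κ → κ ≤ κ₀ → ∃ (rc Ncol Nrow NY CJ Nρ ND κ' : ℝ) (ηin : ℕ → ℝ) (j₁ : ℕ), 0 < rc ∧ 0 ≤ Ncol ∧ 0 ≤ Nrow ∧ 0 ≤ NY ∧ 0 ≤ CJ ∧ 0 ≤ Nρ ∧ 0 ≤ ND ∧ κ < κ' ∧ (∀ n, 0 ≤ ηin n) ∧ Summable ηin ∧ Summable (fun i => ∑' k, ηin (k + i)) ∧ Tendsto (fun j => (∑' k, ηin (k + j)) * ((1 + 2 * ((F.L : ℝ) ^ j / γ) * (Fintype.card (Plaq (F.P j) 0) : ℝ)) * (Fintype.card (PBond (F.P j) 0) : ℝ) ^ 2)) atTop (𝓝 0) ∧ j₀ ≤ j₁ ∧ ∀ (ν : ℕ → (j : ℕ) → MeasureTheory.Measure (GaugeField (F.P j) 0 ↥(Matrix.specialUnitaryGroup (Fin 2) ℂ))), (∀ K, ν K K = T4GenFunBounds.gibbsMeasure (F.P K) ((F.scheme ℰp γ).β K)) → (∀ K j, j < K → ν K j = Measure.map (descend F ℰp j) (ν K (j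 + 1))) → ∀ (K K' : ℕ), K ≤ K' → ∀ (Ts T : ℕ), Ts < T → T ≤ K → ∀ (μ μ' : ((j : ℕ) → MeasureTheory.Measure (GaugeField (F.P j) 0 ↥(Matrix.specialUnitaryGroup (Fin 2) ℂ)))) (ρ ρ' : ((j : ℕ) → GaugeField (F.P j) 0 ↥(Matrix.specialUnitaryGroup (Fin 2) ℂ) → ℝ)), (∀ j : ℕ, Ts ≤ j → j ≤ T → μ j = ν K j ∧ μ' j = ν K' j) → (∀ j : ℕ, j < Ts → μ j = Measure.map (descend F ℰp j) ((μ (j + 1)).withDensity (fun U => ENNReal.ofReal ((∏ p : Plaq _ _, max 0 (min 1 ((24 / 25 * (θBal F.L γ b₀ p₀ (j + 1)) - dist1 (GaugeField.plaqHol U p)) / ((24 / 25 - 1 / 2) * (θBal F.L γ b₀ p₀ (j + 1))))))))) ∧ μ' j = Measure.map (descend F ℰp j) ((μ' (j + 1)).withDensity (fun U => ENNReal.ofReal ((∏ p : Plaq _ _, max 0 (min 1 ((24 / 25 * (θBal F.L γ b₀ p₀ (j + 1)) - dist1 (GaugeField.plaqHol U p)) / ((24 / 25 - 1 / 2) * (θBal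 F.L γ b₀ p₀ (j + 1)))))))))) → (∀ j : ℕ, Ts ≤ j → j < T → μ j = Measure.map (descend F ℰp j) (μ (j + 1)) ∧ μ' j = Measure.map (descend F ℰp j) (μ' (j + 1))) → (∀ j : ℕ, j ≤ T → IsFiniteMeasure (μ j) ∧ IsFiniteMeasure (μ' j)) → (∀ j : ℕ, j₀ ≤ j → j ≤ T → ((∀ U, PlaqSmall (θBal F.L γ b₀ p₀ j) U → 0 < ρ j U ∧ 0 < ρ' j U) ∧ μ j = (fieldMeasure _ _ _).withDensity (fun U => ENNReal.ofReal (ρ j U)) ∧ μ' j = (fieldMeasure _ _ _).withDensity (fun U => ENNReal.ofReal (ρ' j U)) ∧ (∃ κ : ℝ, MemAtHeight F ℰp j (prm j) (fun U => Real.exp κ * ρ j U)) ∧ (∃ κ : ℝ, MemAtHeight F ℰp j (prm j) (fun U => Real.exp κ * ρ' j U)) ∧ μ j {U | ¬ PlaqSmall (θBal F.L γ b₀ p₀ j) U} ≤ ENNReal.ofReal (η j) ∧ μ' j {U | ¬ PlaqSmall (θBal F.L γ b₀ p₀ j) U} ≤ ENNReal.ofReal (η j) ∧ (ContinuousOn (ρ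 j) {U | PlaqSmall (θBal F.L γ b₀ p₀ j) U} ∧ ContinuousOn (ρ' j) {U | PlaqSmall (θBal F.L γ b₀ p₀ j) U}) ∧ ((∀ (U : GaugeField _ _ ↥(Matrix.specialUnitaryGroup (Fin 2) ℂ)), PlaqSmall (θBal F.L γ b₀ p₀ j / 2) U → ∀ (b b' : PBond _ _) (v v' : Fin 3 → ℝ), ‖v‖ ≤ 1 → ‖v'‖ ≤ 1 → ∃ g : ℂ × ℂ → ℂ, DifferentiableOn ℂ g (Metric.ball (0 : ℂ) (rA * (θBal F.L γ b₀ p₀ j / 2)) ×ˢ Metric.ball (0 : ℂ) (rA * (θBal F.L γ b₀ p₀ j / 2))) ∧ (∀ (s t : ℝ) (V Z : GaugeField _ _ ↥(Matrix.specialUnitaryGroup (Fin 2) ℂ)), |s| < rA * (θBal F.L γ b₀ p₀ j / 2) → |t| < rA * (θBal F.L γ b₀ p₀ j / 2) → (∀ e, e ≠ b → V e = U e) → V b = U b * expPt (s • v) → (∀ e, e ≠ b' → Z e = V e) → Z b' = V b' * expPt (t • v') → g ((s : ℂ), (t : ℂ)) = (((Real.log (ρ j Z)) : ℝ) : ℂ))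 ∧ ∀ z ∈ Metric.ball (0 : ℂ) (rA * (θBal F.L γ b₀ p₀ j / 2)) ×ˢ Metric.ball (0 : ℂ) (rA * (θBal F.L γ b₀ p₀ j / 2)), ‖g z - g 0‖ ≤ (Bρ j)) ∧ (∀ (U : GaugeField _ _ ↥(Matrix.specialUnitaryGroup (Fin 2) ℂ)), PlaqSmall (θBal F.L γ b₀ p₀ j / 2) U → ∀ (b b' : PBond _ _) (v v' : Fin 3 → ℝ), ‖v‖ ≤ 1 → ‖v'‖ ≤ 1 → ∃ g : ℂ × ℂ → ℂ, DifferentiableOn ℂ g (Metric.ball (0 : ℂ) (rA * (θBal F.L γ b₀ p₀ j / 2)) ×ˢ Metric.ball (0 : ℂ) (rA * (θBal F.L γ b₀ p₀ j / 2))) ∧ (∀ (s t : ℝ) (V Z : GaugeField _ _ ↥(Matrix.specialUnitaryGroup (Fin 2) ℂ)), |s| < rA * (θBal F.L γ b₀ p₀ j / 2) → |t| < rA * (θBal F.L γ b₀ p₀ j / 2) → (∀ e, e ≠ b → V e = U e) → V b = U b * expPt (s • v) → (∀ e, e ≠ b' → Z e = V e) → Z b' = V b' * expPt (t • v') → g ((s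 : ℂ), (t : ℂ)) = (((Real.log (ρ' j Z)) : ℝ) : ℂ)) ∧ ∀ z ∈ Metric.ball (0 : ℂ) (rA * (θBal F.L γ b₀ p₀ j / 2)) ×ˢ Metric.ball (0 : ℂ) (rA * (θBal F.L γ b₀ p₀ j / 2)), ‖g z - g 0‖ ≤ (Bρ j))))) → ∀ (j : ℕ), j₁ ≤ j → ∀ (hjTs : j + 1 ≤ Ts), ∃ (Z : Type) (_ : MeasurableSpace Z) (τ : MeasureTheory.Measure Z) (Φ : GaugeField (F.P j) 0 ↥(Matrix.specialUnitaryGroup (Fin 2) ℂ) × Z → GaugeField (F.P Ts) 0 ↥(Matrix.specialUnitaryGroup (Fin 2) ℂ)) (J : GaugeField (F.P j) 0 ↥(Matrix.specialUnitaryGroup (Fin 2) ℂ) × Z → NNReal) (S : Set (GaugeField (F.P Ts) 0 ↥(Matrix.specialUnitaryGroup (Fin 2) ℂ))) (E : Z → GaugeField (F.P j) 0 ↥(Matrix.specialUnitaryGroup (Fin 2) ℂ) → PBond (F.P j) 0 → (Fin 3 → ℝ) → List (PBond (F.P Ts) 0 × (Fin 3 → ℝ))) (Corr : Z → GaugeField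 (F.P j) 0 ↥(Matrix.specialUnitaryGroup (Fin 2) ℂ) → PBond (F.P j) 0 → (Fin 3 → ℝ) → PBond (F.P j) 0 → (Fin 3 → ℝ) → List (PBond (F.P Ts) 0 × (Fin 3 → ℝ))) (Xl : PBond (F.P Ts) 0 → PBond (F.P j) 0 → ℝ) (Yl : PBond (F.P Ts) 0 → PBond (F.P j) 0 → PBond (F.P j) 0 → ℝ) (dX : PBond (F.P Ts) 0 → PBond (F.P j) 0 → ℝ) (ρ₁ : PBond (F.P j) 0 → ℝ) (ρ₂ : PBond (F.P j) 0 → PBond (F.P j) 0 → ℝ) (dP : Plaq (F.P Ts) 0 → PBond (F.P j) 0 → ℝ) (Dp : Plaq (F.P Ts) 0 → ℝ), MeasureTheory.IsProbabilityMeasure τ ∧ Measurable Φ ∧ Measurable J ∧ MeasurableSet S ∧ (∀ U : GaugeField (F.P Ts) 0 ↥(Matrix.specialUnitaryGroup (Fin 2) ℂ), (∀ (n : ℕ) (hjn : j + 1 ≤ n) (hnK : n ≤ Ts), PlaqSmall (24 / 25 * θBal F.L γ b₀ p₀ n) (descendTo F ℰp n Ts hnK U)) → U ∈ S) ∧ (∀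 V z, descendTo F ℰp j Ts (Nat.le_of_succ_le hjTs) (Φ (V, z)) = V) ∧ (∀ A : Set (GaugeField (F.P j) 0 ↥(Matrix.specialUnitaryGroup (Fin 2) ℂ)), MeasurableSet A → (fieldMeasure (F.P Ts) 0 ↥(Matrix.specialUnitaryGroup (Fin 2) ℂ)).restrict (descendTo F ℰp j Ts (Nat.le_of_succ_le hjTs) ⁻¹' A ∩ S) = ((((fieldMeasure (F.P j) 0 ↥(Matrix.specialUnitaryGroup (Fin 2) ℂ)).restrict A).prod τ).withDensity (fun p => (J p : ENNReal))).map Φ) ∧ (∀ f : GaugeField (F.P Ts) 0 ↥(Matrix.specialUnitaryGroup (Fin 2) ℂ) → ℝ, Continuous f → (∀ U, f U ≠ 0 → (∀ (n : ℕ) (hjn : j + 1 ≤ n) (hnK : n ≤ Ts), PlaqSmall (24 / 25 * θBal F.L γ b₀ p₀ n) (descendTo F ℰp n Ts hnK U))) → ∀ z, ContinuousOn (fun V => (J (V, z) : ℝ) * f (Φ (V, z))) {V | PlaqSmall (θBal F.L γ b₀ p₀ j) V}) ∧ (∀ V z, (J (V, z) : ℝ) ≤ CJ) ∧ (∀ V,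 PlaqSmall (θBal F.L γ b₀ p₀ j) V → 0 < ∫⁻ z in {z | (∀ (n : ℕ) (hjn : j + 1 ≤ n) (hnK : n ≤ Ts), PlaqSmall (24 / 25 * θBal F.L γ b₀ p₀ n) (descendTo F ℰp n Ts hnK (Φ (V, z))))}, (J (V, z) : ENNReal) ∂τ) ∧ (∀ (z : Z) (V : GaugeField (F.P j) 0 ↥(Matrix.specialUnitaryGroup (Fin 2) ℂ)) (Bc : PBond (F.P j) 0) (m : (Fin 3 → ℝ)), PlaqSmall (θBal F.L γ b₀ p₀ j / 4) V → ‖m‖ ≤ rc * (θBal F.L γ b₀ p₀ j / 4) → (E z V Bc m).foldl (fun U p => Function.update U p.1 (U p.1 * expPt p.2)) (Φ (V, z)) = Φ ((Function.update V Bc (V Bc * expPt m)), z)) ∧ (∀ (z : Z) (V : GaugeField (F.P j) 0 ↥(Matrix.specialUnitaryGroup (Fin 2) ℂ)) (Bc : PBond (F.P j) 0) (m : (Fin 3 → ℝ)) (Bc' : PBond (F.P j) 0) (m' : (Fin 3 → ℝ)), PlaqSmall (θBal F.L γ b₀ p₀ j / 4) V → ‖m‖ ≤ rc * (θBal F.L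 γ b₀ p₀ j / 4) → ‖m'‖ ≤ rc * (θBal F.L γ b₀ p₀ j / 4) → (Corr z V Bc m Bc' m').foldl (fun U p => Function.update U p.1 (U p.1 * expPt p.2)) ((E z V Bc' m').foldl (fun U p => Function.update U p.1 (U p.1 * expPt p.2)) ((E z V Bc m).foldl (fun U p => Function.update U p.1 (U p.1 * expPt p.2)) (Φ (V, z)))) = Φ ((Function.update (Function.update V Bc (V Bc * expPt m)) Bc' ((Function.update V Bc (V Bc * expPt m)) Bc' * expPt m')), z)) ∧ (∀ (z : Z) (V : GaugeField (F.P j) 0 ↥(Matrix.specialUnitaryGroup (Fin 2) ℂ)) (Bc : PBond (F.P j) 0) (m : (Fin 3 → ℝ)), PlaqSmall (θBal F.L γ b₀ p₀ j / 4) V → ‖m‖ ≤ rc * (θBal F.L γ b₀ p₀ j / 4) → ∀ a ∈ E z V Bc m, Real.sqrt 3 * (‖a.2‖ / (θBal F.L γ b₀ p₀ Ts / 4)) ≤ rA / 2) ∧ (∀ (z : Z) (V : GaugeField (F.P j) 0 ↥(Matrix.specialUnitaryGroup (Fin 2) ℂ)) (Bc : PBond (F.P j) 0) (m : (Fin 3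 → ℝ)) (Bc' : PBond (F.P j) 0) (m' : (Fin 3 → ℝ)), PlaqSmall (θBal F.L γ b₀ p₀ j / 4) V → ‖m‖ ≤ rc * (θBal F.L γ b₀ p₀ j / 4) → ‖m'‖ ≤ rc * (θBal F.L γ b₀ p₀ j / 4) → ∀ d ∈ Corr z V Bc m Bc' m', ‖d.2‖ / (θBal F.L γ b₀ p₀ Ts / 4) ≤ rA / 2) ∧ (∀ (z : Z) (V : GaugeField (F.P j) 0 ↥(Matrix.specialUnitaryGroup (Fin 2) ℂ)) (Bc : PBond (F.P j) 0) (m : (Fin 3 → ℝ)) (Bc' : PBond (F.P j) 0) (m' : (Fin 3 → ℝ)), PlaqSmall (θBal F.L γ b₀ p₀ j / 4) V → ‖m‖ ≤ rc * (θBal F.L γ b₀ p₀ j / 4) → ‖m'‖ ≤ rc * (θBal F.L γ b₀ p₀ j / 4) → Φ (V, z) ∈ S → (∀ i l, i ≤ (E z V Bc m).length → l ≤ (E z V Bc' m').length → PlaqSmall (23 / 25 * θBal F.L γ b₀ p₀ Ts) (((E z V Bc' m').take l).foldl (fun U p => Function.update U p.1 (U p.1 * expPt p.2)) (((E z V Bc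 m).take i).foldl (fun U p => Function.update U p.1 (U p.1 * expPt p.2)) (Φ (V, z))))) ∧ (∀ i, i < (Corr z V Bc m Bc' m').length → PlaqSmall (23 / 25 * θBal F.L γ b₀ p₀ Ts) (((Corr z V Bc m Bc' m').take i).foldl (fun U p => Function.update U p.1 (U p.1 * expPt p.2)) ((E z V Bc' m').foldl (fun U p => Function.update U p.1 (U p.1 * expPt p.2)) ((E z V Bc m).foldl (fun U p => Function.update U p.1 (U p.1 * expPt p.2)) (Φ (V, z))))))) ∧ (∀ (z : Z) (V : GaugeField (F.P j) 0 ↥(Matrix.specialUnitaryGroup (Fin 2) ℂ)) (Bc : PBond (F.P j) 0) (m : (Fin 3 → ℝ)) (Bc' : PBond (F.P j) 0) (m' : (Fin 3 → ℝ)), PlaqSmall (θBal F.L γ b₀ p₀ j / 4) V → ‖m‖ ≤ rc * (θBal F.L γ b₀ p₀ j / 4) → ‖m'‖ ≤ rc * (θBal F.L γ b₀ p₀ j / 4) → PlaqSmall (θBal F.L γ b₀ p₀ Ts / 8) (Φ (V, z)) → (∀ i l, i ≤ (E z V Bc m).length → l ≤ (E z V Bc' m').length → PlaqSmall (θBal F.L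 γ b₀ p₀ Ts / 4) (((E z V Bc' m').take l).foldl (fun U p => Function.update U p.1 (U p.1 * expPt p.2)) (((E z V Bc m).take i).foldl (fun U p => Function.update U p.1 (U p.1 * expPt p.2)) (Φ (V, z))))) ∧ (∀ i, i < (Corr z V Bc m Bc' m').length → PlaqSmall (θBal F.L γ b₀ p₀ Ts / 4) (((Corr z V Bc m Bc' m').take i).foldl (fun U p => Function.update U p.1 (U p.1 * expPt p.2)) ((E z V Bc' m').foldl (fun U p => Function.update U p.1 (U p.1 * expPt p.2)) ((E z V Bc m).foldl (fun U p => Function.update U p.1 (U p.1 * expPt p.2)) (Φ (V, z))))))) ∧ (∀ a Bc, 0 ≤ Xl a Bc) ∧ (∀ d Bc Bc', 0 ≤ Yl d Bc Bc') ∧ (∀ a Bc, 0 ≤ dX a Bc) ∧ (∀ (z : Z) (V : GaugeField (F.P j) 0 ↥(Matrix.specialUnitaryGroup (Fin 2) ℂ)) (Bc : PBond (F.P j) 0) (m : (Fin 3 → ℝ)) (a₀ : PBond (F.P Ts) 0), PlaqSmall (θBal F.L γ b₀ p₀ j / 4) V → ‖m‖ ≤ rc * (θBal F.L γ b₀ p₀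 j / 4) → (((E z V Bc m).filter (fun p => decide (p.1 = a₀))).map (fun p => ‖p.2‖ / (θBal F.L γ b₀ p₀ Ts / 4))).sum ≤ Xl a₀ Bc * (‖m‖ / (θBal F.L γ b₀ p₀ j / 4))) ∧ (∀ (z : Z) (V : GaugeField (F.P j) 0 ↥(Matrix.specialUnitaryGroup (Fin 2) ℂ)) (Bc : PBond (F.P j) 0) (m : (Fin 3 → ℝ)) (Bc' : PBond (F.P j) 0) (m' : (Fin 3 → ℝ)) (d₀ : PBond (F.P Ts) 0), PlaqSmall (θBal F.L γ b₀ p₀ j / 4) V → ‖m‖ ≤ rc * (θBal F.L γ b₀ p₀ j / 4) → ‖m'‖ ≤ rc * (θBal F.L γ b₀ p₀ j / 4) → (((Corr z V Bc m Bc' m').filter (fun p => decide (p.1 = d₀))).map (fun p => ‖p.2‖ / (θBal F.L γ b₀ p₀ Ts / 4))).sum ≤ Yl d₀ Bc Bc' * (‖m‖ / (θBal F.L γ b₀ p₀ j / 4)) * (‖m'‖ / (θBal F.L γ b₀ p₀ j / 4))) ∧ (∀ Bc, ∑ a, Xl a Bc * Real.exp (κ * dX a Bc) ≤ Ncol) ∧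 (∀ a, ∑ Bc, Xl a Bc * Real.exp (κ * dX a Bc) ≤ Nrow) ∧ (∀ Bc, ∑ d, ∑ Bc', Yl d Bc Bc' * Real.exp (κ * (Bc.src.tdist Bc'.src : ℝ)) ≤ NY) ∧ (∀ (a c : PBond (F.P Ts) 0) (Bc Bc' : PBond (F.P j) 0), (Bc.src.tdist Bc'.src : ℝ) ≤ dX a Bc + (a.src.tdist c.src : ℝ) + dX c Bc') ∧ (∀ Bc, 0 ≤ ρ₁ Bc) ∧ (∀ Bc Bc', 0 ≤ ρ₂ Bc Bc') ∧ (∀ Bc, ρ₁ Bc ≤ Nρ) ∧ (∀ Bc, ∑ Bc', ρ₂ Bc Bc' * Real.exp (κ * (Bc.src.tdist Bc'.src : ℝ)) ≤ Nρ) ∧ (∀ (V : GaugeField (F.P j) 0 ↥(Matrix.specialUnitaryGroup (Fin 2) ℂ)) (Bc : PBond (F.P j) 0) (m : (Fin 3 → ℝ)) (Bc' : PBond (F.P j) 0) (m' : (Fin 3 → ℝ)), PlaqSmall (θBal F.L γ b₀ p₀ j / 4) V → ‖m‖ ≤ rc * (θBal F.L γ b₀ p₀ j / 4) → ‖m'‖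 ≤ rc * (θBal F.L γ b₀ p₀ j / 4) → Real.sqrt (∫ z, (((((∏ i ∈ Finset.range (Ts - j), (if h : j + 1 + i ≤ Ts then (∏ p : Plaq (F.P (j + 1 + i)) 0, max 0 (min 1 ((24 / 25 * θBal F.L γ b₀ p₀ (j + 1 + i) - dist1 (GaugeField.plaqHol (descendTo F ℰp (j + 1 + i) Ts h (Φ ((Function.update V Bc (V Bc * expPt m)), z))) p)) / ((24 / 25 - 1 / 2) * θBal F.L γ b₀ p₀ (j + 1 + i))))) else 1))) * ρ' Ts (Φ ((Function.update V Bc (V Bc * expPt m)), z)) * (J ((Function.update V Bc (V Bc * expPt m)), z) : ℝ)) / (∫ z, (((∏ i ∈ Finset.range (Ts - j), (if h : j + 1 + i ≤ Ts then (∏ p : Plaq (F.P (j + 1 + i)) 0, max 0 (min 1 ((24 / 25 * θBal F.L γ b₀ p₀ (j + 1 + i) - dist1 (GaugeField.plaqHol (descendTo F ℰp (j + 1 + i) Ts h (Φ ((Function.update V Bc (V Bc * expPt m)), z))) p)) / ((24 / 25 - 1 / 2) * θBal F.L γ b₀ p₀ (j + 1 + i))))) else 1))) * ρ' Ts (Φ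 ((Function.update V Bc (V Bc * expPt m)), z)) * (J ((Function.update V Bc (V Bc * expPt m)), z) : ℝ)) ∂τ)) / ((((∏ i ∈ Finset.range (Ts - j), (if h : j + 1 + i ≤ Ts then (∏ p : Plaq (F.P (j + 1 + i)) 0, max 0 (min 1 ((24 / 25 * θBal F.L γ b₀ p₀ (j + 1 + i) - dist1 (GaugeField.plaqHol (descendTo F ℰp (j + 1 + i) Ts h (Φ (V, z))) p)) / ((24 / 25 - 1 / 2) * θBal F.L γ b₀ p₀ (j + 1 + i))))) else 1))) * ρ' Ts (Φ (V, z)) * (J (V, z) : ℝ)) / (∫ z, (((∏ i ∈ Finset.range (Ts - j), (if h : j + 1 + i ≤ Ts then (∏ p : Plaq (F.P (j + 1 + i)) 0, max 0 (min 1 ((24 / 25 * θBal F.L γ b₀ p₀ (j + 1 + i) - dist1 (GaugeField.plaqHol (descendTo F ℰp (j + 1 + i) Ts h (Φ (V, z))) p)) / ((24 / 25 - 1 / 2) * θBal F.L γ b₀ p₀ (j + 1 + i))))) else 1))) * ρ' Ts (Φ (V, z)) * (J (V, z) : ℝ)) ∂τ)) - 1) ^ 2 * ((((∏ i ∈ Finset.range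 (Ts - j), (if h : j + 1 + i ≤ Ts then (∏ p : Plaq (F.P (j + 1 + i)) 0, max 0 (min 1 ((24 / 25 * θBal F.L γ b₀ p₀ (j + 1 + i) - dist1 (GaugeField.plaqHol (descendTo F ℰp (j + 1 + i) Ts h (Φ (V, z))) p)) / ((24 / 25 - 1 / 2) * θBal F.L γ b₀ p₀ (j + 1 + i))))) else 1))) * ρ' Ts (Φ (V, z)) * (J (V, z) : ℝ)) / (∫ z, (((∏ i ∈ Finset.range (Ts - j), (if h : j + 1 + i ≤ Ts then (∏ p : Plaq (F.P (j + 1 + i)) 0, max 0 (min 1 ((24 / 25 * θBal F.L γ b₀ p₀ (j + 1 + i) - dist1 (GaugeField.plaqHol (descendTo F ℰp (j + 1 + i) Ts h (Φ (V, z))) p)) / ((24 / 25 - 1 / 2) * θBal F.L γ b₀ p₀ (j + 1 + i))))) else 1))) * ρ' Ts (Φ (V, z)) * (J (V, z) : ℝ)) ∂τ)) ∂τ) ≤ ρ₁ Bc * (‖m‖ / (θBal F.L γ b₀ p₀ j / 4)) ∧ Real.sqrt (∫ z, (((((∏ i ∈ Finset.range (Ts - j), (if h : j + 1 + i ≤ Ts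 then (∏ p : Plaq (F.P (j + 1 + i)) 0, max 0 (min 1 ((24 / 25 * θBal F.L γ b₀ p₀ (j + 1 + i) - dist1 (GaugeField.plaqHol (descendTo F ℰp (j + 1 + i) Ts h (Φ ((Function.update (Function.update V Bc (V Bc * expPt m)) Bc' ((Function.update V Bc (V Bc * expPt m)) Bc' * expPt m')), z))) p)) / ((24 / 25 - 1 / 2) * θBal F.L γ b₀ p₀ (j + 1 + i))))) else 1))) * ρ' Ts (Φ ((Function.update (Function.update V Bc (V Bc * expPt m)) Bc' ((Function.update V Bc (V Bc * expPt m)) Bc' * expPt m')), z)) * (J ((Function.update (Function.update V Bc (V Bc * expPt m)) Bc' ((Function.update V Bc (V Bc * expPt m)) Bc' * expPt m')), z) : ℝ)) / (∫ z, (((∏ i ∈ Finset.range (Ts - j), (if h : j + 1 + i ≤ Ts then (∏ p : Plaq (F.P (j + 1 + i)) 0, max 0 (min 1 ((24 / 25 * θBal F.L γ b₀ p₀ (j + 1 + i) - dist1 (GaugeField.plaqHol (descendTo F ℰp (j + 1 + i) Ts h (Φ ((Function.update (Function.update V Bc (V Bc * expPt m)) Bc' ((Function.update V Bc (V Bc *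 expPt m)) Bc' * expPt m')), z))) p)) / ((24 / 25 - 1 / 2) * θBal F.L γ b₀ p₀ (j + 1 + i))))) else 1))) * ρ' Ts (Φ ((Function.update (Function.update V Bc (V Bc * expPt m)) Bc' ((Function.update V Bc (V Bc * expPt m)) Bc' * expPt m')), z)) * (J ((Function.update (Function.update V Bc (V Bc * expPt m)) Bc' ((Function.update V Bc (V Bc * expPt m)) Bc' * expPt m')), z) : ℝ)) ∂τ)) / ((((∏ i ∈ Finset.range (Ts - j), (if h : j + 1 + i ≤ Ts then (∏ p : Plaq (F.P (j + 1 + i)) 0, max 0 (min 1 ((24 / 25 * θBal F.L γ b₀ p₀ (j + 1 + i) - dist1 (GaugeField.plaqHol (descendTo F ℰp (j + 1 + i) Ts h (Φ (V, z))) p)) / ((24 / 25 - 1 / 2) * θBal F.L γ b₀ p₀ (j + 1 + i))))) else 1))) * ρ' Ts (Φ (V, z)) * (J (V, z) : ℝ)) / (∫ z, (((∏ i ∈ Finset.range (Ts - j), (if h : j + 1 + i ≤ Ts then (∏ p : Plaq (F.P (j + 1 + i)) 0, max 0 (min 1 ((24 / 25 * θBal F.L γ b₀ p₀ (j + 1 +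 i) - dist1 (GaugeField.plaqHol (descendTo F ℰp (j + 1 + i) Ts h (Φ (V, z))) p)) / ((24 / 25 - 1 / 2) * θBal F.L γ b₀ p₀ (j + 1 + i))))) else 1))) * ρ' Ts (Φ (V, z)) * (J (V, z) : ℝ)) ∂τ)) - ((((∏ i ∈ Finset.range (Ts - j), (if h : j + 1 + i ≤ Ts then (∏ p : Plaq (F.P (j + 1 + i)) 0, max 0 (min 1 ((24 / 25 * θBal F.L γ b₀ p₀ (j + 1 + i) - dist1 (GaugeField.plaqHol (descendTo F ℰp (j + 1 + i) Ts h (Φ ((Function.update V Bc (V Bc * expPt m)), z))) p)) / ((24 / 25 - 1 / 2) * θBal F.L γ b₀ p₀ (j + 1 + i))))) else 1))) * ρ' Ts (Φ ((Function.update V Bc (V Bc * expPt m)), z)) * (J ((Function.update V Bc (V Bc * expPt m)), z) : ℝ)) / (∫ z, (((∏ i ∈ Finset.range (Ts - j), (if h : j + 1 + i ≤ Ts then (∏ p : Plaq (F.P (j + 1 + i)) 0, max 0 (min 1 ((24 / 25 * θBal F.L γ b₀ p₀ (j + 1 + i) - dist1 (GaugeField.plaqHol (descendTo F ℰp (j +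 1 + i) Ts h (Φ ((Function.update V Bc (V Bc * expPt m)), z))) p)) / ((24 / 25 - 1 / 2) * θBal F.L γ b₀ p₀ (j + 1 + i))))) else 1))) * ρ' Ts (Φ ((Function.update V Bc (V Bc * expPt m)), z)) * (J ((Function.update V Bc (V Bc * expPt m)), z) : ℝ)) ∂τ)) / ((((∏ i ∈ Finset.range (Ts - j), (if h : j + 1 + i ≤ Ts then (∏ p : Plaq (F.P (j + 1 + i)) 0, max 0 (min 1 ((24 / 25 * θBal F.L γ b₀ p₀ (j + 1 + i) - dist1 (GaugeField.plaqHol (descendTo F ℰp (j + 1 + i) Ts h (Φ (V, z))) p)) / ((24 / 25 - 1 / 2) * θBal F.L γ b₀ p₀ (j + 1 + i))))) else 1))) * ρ' Ts (Φ (V, z)) * (J (V, z) : ℝ)) / (∫ z, (((∏ i ∈ Finset.range (Ts - j), (if h : j + 1 + i ≤ Ts then (∏ p : Plaq (F.P (j + 1 + i)) 0, max 0 (min 1 ((24 / 25 * θBal F.L γ b₀ p₀ (j + 1 + i) - dist1 (GaugeField.plaqHol (descendTo F ℰp (j + 1 + i) Ts h (Φ (V, z))) p)) / ((24 / 25 -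 1 / 2) * θBal F.L γ b₀ p₀ (j + 1 + i))))) else 1))) * ρ' Ts (Φ (V, z)) * (J (V, z) : ℝ)) ∂τ))) ^ 2 * ((((∏ i ∈ Finset.range (Ts - j), (if h : j + 1 + i ≤ Ts then (∏ p : Plaq (F.P (j + 1 + i)) 0, max 0 (min 1 ((24 / 25 * θBal F.L γ b₀ p₀ (j + 1 + i) - dist1 (GaugeField.plaqHol (descendTo F ℰp (j + 1 + i) Ts h (Φ (V, z))) p)) / ((24 / 25 - 1 / 2) * θBal F.L γ b₀ p₀ (j + 1 + i))))) else 1))) * ρ' Ts (Φ (V, z)) * (J (V, z) : ℝ)) / (∫ z, (((∏ i ∈ Finset.range (Ts - j), (if h : j + 1 + i ≤ Ts then (∏ p : Plaq (F.P (j + 1 + i)) 0, max 0 (min 1 ((24 / 25 * θBal F.L γ b₀ p₀ (j + 1 + i) - dist1 (GaugeField.plaqHol (descendTo F ℰp (j + 1 + i) Ts h (Φ (V, z))) p)) / ((24 / 25 - 1 / 2) * θBal F.L γ b₀ p₀ (j + 1 + i))))) else 1))) * ρ' Ts (Φ (V, z)) * (J (V, z) : ℝ)) ∂τ)) ∂τ)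 ≤ ρ₁ Bc' * (‖m'‖ / (θBal F.L γ b₀ p₀ j / 4)) ∧ Real.sqrt (∫ z, (((((∏ i ∈ Finset.range (Ts - j), (if h : j + 1 + i ≤ Ts then (∏ p : Plaq (F.P (j + 1 + i)) 0, max 0 (min 1 ((24 / 25 * θBal F.L γ b₀ p₀ (j + 1 + i) - dist1 (GaugeField.plaqHol (descendTo F ℰp (j + 1 + i) Ts h (Φ ((Function.update (Function.update V Bc (V Bc * expPt m)) Bc' ((Function.update V Bc (V Bc * expPt m)) Bc' * expPt m')), z))) p)) / ((24 / 25 - 1 / 2) * θBal F.L γ b₀ p₀ (j + 1 + i))))) else 1))) * ρ' Ts (Φ ((Function.update (Function.update V Bc (V Bc * expPt m)) Bc' ((Function.update V Bc (V Bc * expPt m)) Bc' * expPt m')), z)) * (J ((Function.update (Function.update V Bc (V Bc * expPt m)) Bc' ((Function.update V Bc (V Bc * expPt m)) Bc' * expPt m')), z) : ℝ)) / (∫ z, (((∏ i ∈ Finset.range (Ts - j), (if h : j + 1 + i ≤ Ts then (∏ p : Plaq (F.P (j + 1 + i)) 0, max 0 (min 1 ((24 / 25 * θBal F.L γ b₀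 p₀ (j + 1 + i) - dist1 (GaugeField.plaqHol (descendTo F ℰp (j + 1 + i) Ts h (Φ ((Function.update (Function.update V Bc (V Bc * expPt m)) Bc' ((Function.update V Bc (V Bc * expPt m)) Bc' * expPt m')), z))) p)) / ((24 / 25 - 1 / 2) * θBal F.L γ b₀ p₀ (j + 1 + i))))) else 1))) * ρ' Ts (Φ ((Function.update (Function.update V Bc (V Bc * expPt m)) Bc' ((Function.update V Bc (V Bc * expPt m)) Bc' * expPt m')), z)) * (J ((Function.update (Function.update V Bc (V Bc * expPt m)) Bc' ((Function.update V Bc (V Bc * expPt m)) Bc' * expPt m')), z) : ℝ)) ∂τ)) / ((((∏ i ∈ Finset.range (Ts - j), (if h : j + 1 + i ≤ Ts then (∏ p : Plaq (F.P (j + 1 + i)) 0, max 0 (min 1 ((24 / 25 * θBal F.L γ b₀ p₀ (j + 1 + i) - dist1 (GaugeField.plaqHol (descendTo F ℰp (j + 1 + i) Ts h (Φ (V, z))) p)) / ((24 / 25 - 1 / 2) * θBal F.L γ b₀ p₀ (j + 1 + i))))) else 1))) * ρ' Ts (Φ (V, z)) * (J (V, z) : ℝ)) / (∫ z, (((∏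 i ∈ Finset.range (Ts - j), (if h : j + 1 + i ≤ Ts then (∏ p : Plaq (F.P (j + 1 + i)) 0, max 0 (min 1 ((24 / 25 * θBal F.L γ b₀ p₀ (j + 1 + i) - dist1 (GaugeField.plaqHol (descendTo F ℰp (j + 1 + i) Ts h (Φ (V, z))) p)) / ((24 / 25 - 1 / 2) * θBal F.L γ b₀ p₀ (j + 1 + i))))) else 1))) * ρ' Ts (Φ (V, z)) * (J (V, z) : ℝ)) ∂τ)) - ((((∏ i ∈ Finset.range (Ts - j), (if h : j + 1 + i ≤ Ts then (∏ p : Plaq (F.P (j + 1 + i)) 0, max 0 (min 1 ((24 / 25 * θBal F.L γ b₀ p₀ (j + 1 + i) - dist1 (GaugeField.plaqHol (descendTo F ℰp (j + 1 + i) Ts h (Φ ((Function.update V Bc (V Bc * expPt m)), z))) p)) / ((24 / 25 - 1 / 2) * θBal F.L γ b₀ p₀ (j + 1 + i))))) else 1))) * ρ' Ts (Φ ((Function.update V Bc (V Bc * expPt m)), z)) * (J ((Function.update V Bc (V Bc * expPt m)), z) : ℝ)) / (∫ z, (((∏ i ∈ Finset.range (Ts - j), (if h : j + 1 + i ≤ Ts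 then (∏ p : Plaq (F.P (j + 1 + i)) 0, max 0 (min 1 ((24 / 25 * θBal F.L γ b₀ p₀ (j + 1 + i) - dist1 (GaugeField.plaqHol (descendTo F ℰp (j + 1 + i) Ts h (Φ ((Function.update V Bc (V Bc * expPt m)), z))) p)) / ((24 / 25 - 1 / 2) * θBal F.L γ b₀ p₀ (j + 1 + i))))) else 1))) * ρ' Ts (Φ ((Function.update V Bc (V Bc * expPt m)), z)) * (J ((Function.update V Bc (V Bc * expPt m)), z) : ℝ)) ∂τ)) / ((((∏ i ∈ Finset.range (Ts - j), (if h : j + 1 + i ≤ Ts then (∏ p : Plaq (F.P (j + 1 + i)) 0, max 0 (min 1 ((24 / 25 * θBal F.L γ b₀ p₀ (j + 1 + i) - dist1 (GaugeField.plaqHol (descendTo F ℰp (j + 1 + i) Ts h (Φ (V, z))) p)) / ((24 / 25 - 1 / 2) * θBal F.L γ b₀ p₀ (j + 1 + i))))) else 1))) * ρ' Ts (Φ (V, z)) * (J (V, z) : ℝ)) / (∫ z, (((∏ i ∈ Finset.range (Ts - j), (if h : j + 1 + i ≤ Ts then (∏ p : Plaq (F.P (j + 1 + i)) 0, max 0 (min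 1 ((24 / 25 * θBal F.L γ b₀ p₀ (j + 1 + i) - dist1 (GaugeField.plaqHol (descendTo F ℰp (j + 1 + i) Ts h (Φ (V, z))) p)) / ((24 / 25 - 1 / 2) * θBal F.L γ b₀ p₀ (j + 1 + i))))) else 1))) * ρ' Ts (Φ (V, z)) * (J (V, z) : ℝ)) ∂τ)) - ((((∏ i ∈ Finset.range (Ts - j), (if h : j + 1 + i ≤ Ts then (∏ p : Plaq (F.P (j + 1 + i)) 0, max 0 (min 1 ((24 / 25 * θBal F.L γ b₀ p₀ (j + 1 + i) - dist1 (GaugeField.plaqHol (descendTo F ℰp (j + 1 + i) Ts h (Φ ((Function.update V Bc' (V Bc' * expPt m')), z))) p)) / ((24 / 25 - 1 / 2) * θBal F.L γ b₀ p₀ (j + 1 + i))))) else 1))) * ρ' Ts (Φ ((Function.update V Bc' (V Bc' * expPt m')), z)) * (J ((Function.update V Bc' (V Bc' * expPt m')), z) : ℝ)) / (∫ z, (((∏ i ∈ Finset.range (Ts - j), (if h : j + 1 + i ≤ Ts then (∏ p : Plaq (F.P (j + 1 + i)) 0, max 0 (min 1 ((24 / 25 * θBal F.L γ b₀ p₀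 (j + 1 + i) - dist1 (GaugeField.plaqHol (descendTo F ℰp (j + 1 + i) Ts h (Φ ((Function.update V Bc' (V Bc' * expPt m')), z))) p)) / ((24 / 25 - 1 / 2) * θBal F.L γ b₀ p₀ (j + 1 + i))))) else 1))) * ρ' Ts (Φ ((Function.update V Bc' (V Bc' * expPt m')), z)) * (J ((Function.update V Bc' (V Bc' * expPt m')), z) : ℝ)) ∂τ)) / ((((∏ i ∈ Finset.range (Ts - j), (if h : j + 1 + i ≤ Ts then (∏ p : Plaq (F.P (j + 1 + i)) 0, max 0 (min 1 ((24 / 25 * θBal F.L γ b₀ p₀ (j + 1 + i) - dist1 (GaugeField.plaqHol (descendTo F ℰp (j + 1 + i) Ts h (Φ (V, z))) p)) / ((24 / 25 - 1 / 2) * θBal F.L γ b₀ p₀ (j + 1 + i))))) else 1))) * ρ' Ts (Φ (V, z)) * (J (V, z) : ℝ)) / (∫ z, (((∏ i ∈ Finset.range (Ts - j), (if h : j + 1 + i ≤ Ts then (∏ p : Plaq (F.P (j + 1 + i)) 0, max 0 (min 1 ((24 / 25 * θBal F.L γ b₀ p₀ (j + 1 + i) - dist1 (GaugeField.plaqHol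 (descendTo F ℰp (j + 1 + i) Ts h (Φ (V, z))) p)) / ((24 / 25 - 1 / 2) * θBal F.L γ b₀ p₀ (j + 1 + i))))) else 1))) * ρ' Ts (Φ (V, z)) * (J (V, z) : ℝ)) ∂τ)) + 1) ^ 2 * ((((∏ i ∈ Finset.range (Ts - j), (if h : j + 1 + i ≤ Ts then (∏ p : Plaq (F.P (j + 1 + i)) 0, max 0 (min 1 ((24 / 25 * θBal F.L γ b₀ p₀ (j + 1 + i) - dist1 (GaugeField.plaqHol (descendTo F ℰp (j + 1 + i) Ts h (Φ (V, z))) p)) / ((24 / 25 - 1 / 2) * θBal F.L γ b₀ p₀ (j + 1 + i))))) else 1))) * ρ' Ts (Φ (V, z)) * (J (V, z) : ℝ)) / (∫ z, (((∏ i ∈ Finset.range (Ts - j), (if h : j + 1 + i ≤ Ts then (∏ p : Plaq (F.P (j + 1 + i)) 0, max 0 (min 1 ((24 / 25 * θBal F.L γ b₀ p₀ (j + 1 + i) - dist1 (GaugeField.plaqHol (descendTo F ℰp (j + 1 + i) Ts h (Φ (V, z))) p)) / ((24 / 25 - 1 / 2) * θBal F.L γ b₀ p₀ (j + 1 + i)))))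 else 1))) * ρ' Ts (Φ (V, z)) * (J (V, z) : ℝ)) ∂τ)) ∂τ) ≤ ρ₂ Bc Bc' * (‖m‖ / (θBal F.L γ b₀ p₀ j / 4)) * (‖m'‖ / (θBal F.L γ b₀ p₀ j / 4))) ∧ (∀ (V : GaugeField (F.P j) 0 ↥(Matrix.specialUnitaryGroup (Fin 2) ℂ)) (Bc : PBond (F.P j) 0) (m : (Fin 3 → ℝ)) (Bc' : PBond (F.P j) 0) (m' : (Fin 3 → ℝ)) (p : Plaq (F.P Ts) 0) (f : ↥(Matrix.specialUnitaryGroup (Fin 2) ℂ) → ℝ) (Mf : ℝ), PlaqSmall (θBal F.L γ b₀ p₀ j / 4) V → ‖m‖ ≤ rc * (θBal F.L γ b₀ p₀ j / 4) → ‖m'‖ ≤ rc * (θBal F.L γ b₀ p₀ j / 4) → Continuous f → (∀ g, |f g| ≤ Mf) → |∫ z, (f (GaugeField.plaqHol (Φ (V, z)) p) - (∫ z', f (GaugeField.plaqHol (Φ (V, z')) p) * ((((∏ i ∈ Finset.range (Ts - j), (if h : j + 1 + i ≤ Ts then (∏ p : Plaq (F.P (j + 1 + i)) 0, max 0 (min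 1 ((24 / 25 * θBal F.L γ b₀ p₀ (j + 1 + i) - dist1 (GaugeField.plaqHol (descendTo F ℰp (j + 1 + i) Ts h (Φ (V, z'))) p)) / ((24 / 25 - 1 / 2) * θBal F.L γ b₀ p₀ (j + 1 + i))))) else 1))) * ρ' Ts (Φ (V, z')) * (J (V, z') : ℝ)) / (∫ z, (((∏ i ∈ Finset.range (Ts - j), (if h : j + 1 + i ≤ Ts then (∏ p : Plaq (F.P (j + 1 + i)) 0, max 0 (min 1 ((24 / 25 * θBal F.L γ b₀ p₀ (j + 1 + i) - dist1 (GaugeField.plaqHol (descendTo F ℰp (j + 1 + i) Ts h (Φ (V, z))) p)) / ((24 / 25 - 1 / 2) * θBal F.L γ b₀ p₀ (j + 1 + i))))) else 1))) * ρ' Ts (Φ (V, z)) * (J (V, z) : ℝ)) ∂τ)) ∂τ)) * (((((∏ i ∈ Finset.range (Ts - j), (if h : j + 1 + i ≤ Ts then (∏ p : Plaq (F.P (j + 1 + i)) 0, max 0 (min 1 ((24 / 25 * θBal F.L γ b₀ p₀ (j + 1 + i) - dist1 (GaugeField.plaqHol (descendTo F ℰp (j + 1 + i) Ts h (Φ ((Function.update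 (Function.update V Bc (V Bc * expPt m)) Bc' ((Function.update V Bc (V Bc * expPt m)) Bc' * expPt m')), z))) p)) / ((24 / 25 - 1 / 2) * θBal F.L γ b₀ p₀ (j + 1 + i))))) else 1))) * ρ' Ts (Φ ((Function.update (Function.update V Bc (V Bc * expPt m)) Bc' ((Function.update V Bc (V Bc * expPt m)) Bc' * expPt m')), z)) * (J ((Function.update (Function.update V Bc (V Bc * expPt m)) Bc' ((Function.update V Bc (V Bc * expPt m)) Bc' * expPt m')), z) : ℝ)) / (∫ z, (((∏ i ∈ Finset.range (Ts - j), (if h : j + 1 + i ≤ Ts then (∏ p : Plaq (F.P (j + 1 + i)) 0, max 0 (min 1 ((24 / 25 * θBal F.L γ b₀ p₀ (j + 1 + i) - dist1 (GaugeField.plaqHol (descendTo F ℰp (j + 1 + i) Ts h (Φ ((Function.update (Function.update V Bc (V Bc * expPt m)) Bc' ((Function.update V Bc (V Bc * expPt m)) Bc' * expPt m')), z))) p)) / ((24 / 25 - 1 / 2) * θBal F.L γ b₀ p₀ (j + 1 + i))))) else 1))) * ρ' Ts (Φ ((Function.update (Function.update V Bc (V Bc * expPt m)) Bc' ((Function.update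 V Bc (V Bc * expPt m)) Bc' * expPt m')), z)) * (J ((Function.update (Function.update V Bc (V Bc * expPt m)) Bc' ((Function.update V Bc (V Bc * expPt m)) Bc' * expPt m')), z) : ℝ)) ∂τ)) - ((((∏ i ∈ Finset.range (Ts - j), (if h : j + 1 + i ≤ Ts then (∏ p : Plaq (F.P (j + 1 + i)) 0, max 0 (min 1 ((24 / 25 * θBal F.L γ b₀ p₀ (j + 1 + i) - dist1 (GaugeField.plaqHol (descendTo F ℰp (j + 1 + i) Ts h (Φ ((Function.update V Bc (V Bc * expPt m)), z))) p)) / ((24 / 25 - 1 / 2) * θBal F.L γ b₀ p₀ (j + 1 + i))))) else 1))) * ρ' Ts (Φ ((Function.update V Bc (V Bc * expPt m)), z)) * (J ((Function.update V Bc (V Bc * expPt m)), z) : ℝ)) / (∫ z, (((∏ i ∈ Finset.range (Ts - j), (if h : j + 1 + i ≤ Ts then (∏ p : Plaq (F.P (j + 1 + i)) 0, max 0 (min 1 ((24 / 25 * θBal F.L γ b₀ p₀ (j + 1 + i) - dist1 (GaugeField.plaqHol (descendTo F ℰp (j + 1 + i) Ts h (Φ ((Function.update V Bc (V Bc * expPt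 m)), z))) p)) / ((24 / 25 - 1 / 2) * θBal F.L γ b₀ p₀ (j + 1 + i))))) else 1))) * ρ' Ts (Φ ((Function.update V Bc (V Bc * expPt m)), z)) * (J ((Function.update V Bc (V Bc * expPt m)), z) : ℝ)) ∂τ)) - ((((∏ i ∈ Finset.range (Ts - j), (if h : j + 1 + i ≤ Ts then (∏ p : Plaq (F.P (j + 1 + i)) 0, max 0 (min 1 ((24 / 25 * θBal F.L γ b₀ p₀ (j + 1 + i) - dist1 (GaugeField.plaqHol (descendTo F ℰp (j + 1 + i) Ts h (Φ ((Function.update V Bc' (V Bc' * expPt m')), z))) p)) / ((24 / 25 - 1 / 2) * θBal F.L γ b₀ p₀ (j + 1 + i))))) else 1))) * ρ' Ts (Φ ((Function.update V Bc' (V Bc' * expPt m')), z)) * (J ((Function.update V Bc' (V Bc' * expPt m')), z) : ℝ)) / (∫ z, (((∏ i ∈ Finset.range (Ts - j), (if h : j + 1 + i ≤ Ts then (∏ p : Plaq (F.P (j + 1 + i)) 0, max 0 (min 1 ((24 / 25 * θBal F.L γ b₀ p₀ (j + 1 + i) - dist1 (GaugeField.plaqHol (descendTo F ℰp (j + 1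 + i) Ts h (Φ ((Function.update V Bc' (V Bc' * expPt m')), z))) p)) / ((24 / 25 - 1 / 2) * θBal F.L γ b₀ p₀ (j + 1 + i))))) else 1))) * ρ' Ts (Φ ((Function.update V Bc' (V Bc' * expPt m')), z)) * (J ((Function.update V Bc' (V Bc' * expPt m')), z) : ℝ)) ∂τ)) + ((((∏ i ∈ Finset.range (Ts - j), (if h : j + 1 + i ≤ Ts then (∏ p : Plaq (F.P (j + 1 + i)) 0, max 0 (min 1 ((24 / 25 * θBal F.L γ b₀ p₀ (j + 1 + i) - dist1 (GaugeField.plaqHol (descendTo F ℰp (j + 1 + i) Ts h (Φ (V, z))) p)) / ((24 / 25 - 1 / 2) * θBal F.L γ b₀ p₀ (j + 1 + i))))) else 1))) * ρ' Ts (Φ (V, z)) * (J (V, z) : ℝ)) / (∫ z, (((∏ i ∈ Finset.range (Ts - j), (if h : j + 1 + i ≤ Ts then (∏ p : Plaq (F.P (j + 1 + i)) 0, max 0 (min 1 ((24 / 25 * θBal F.L γ b₀ p₀ (j + 1 + i) - dist1 (GaugeField.plaqHol (descendTo F ℰp (j + 1 + i) Ts h (Φ (V, z))) p)) / ((24 /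 25 - 1 / 2) * θBal F.L γ b₀ p₀ (j + 1 + i))))) else 1))) * ρ' Ts (Φ (V, z)) * (J (V, z) : ℝ)) ∂τ))) ∂τ| ≤ Dp p * Mf * Real.exp (-(κ' * dP p Bc)) * (‖m‖ / (θBal F.L γ b₀ p₀ j / 4)) * (‖m'‖ / (θBal F.L γ b₀ p₀ j / 4))) ∧ (∀ p, 0 ≤ Dp p) ∧ (∀ p Bc, 0 ≤ dP p Bc) ∧ (∀ Bc, ∑ p, Dp p * Real.exp (-((κ' - κ) * dP p Bc)) ≤ ND) ∧ (∀ (p : Plaq (F.P Ts) 0) (Bc Bc' : PBond (F.P j) 0), (Bc.src.tdist Bc'.src : ℝ) ≤ dP p Bc + dP p Bc') ∧ (∀ (V : GaugeField (F.P j) 0 ↥(Matrix.specialUnitaryGroup (Fin 2) ℂ)), PlaqSmall (θBal F.L γ b₀ p₀ j / 4) V → ∫ z in {z | ¬ PlaqSmall (θBal F.L γ b₀ p₀ Ts / 8) (Φ (V, z))}, ((((∏ i ∈ Finset.range (Ts - j), (if h : j + 1 + i ≤ Ts then (∏ p : Plaq (F.P (j + 1 + i)) 0, max 0 (min 1 ((24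 / 25 * θBal F.L γ b₀ p₀ (j + 1 + i) - dist1 (GaugeField.plaqHol (descendTo F ℰp (j + 1 + i) Ts h (Φ (V, z))) p)) / ((24 / 25 - 1 / 2) * θBal F.L γ b₀ p₀ (j + 1 + i))))) else 1))) * ρ' Ts (Φ (V, z)) * (J (V, z) : ℝ)) / (∫ z, (((∏ i ∈ Finset.range (Ts - j), (if h : j + 1 + i ≤ Ts then (∏ p : Plaq (F.P (j + 1 + i)) 0, max 0 (min 1 ((24 / 25 * θBal F.L γ b₀ p₀ (j + 1 + i) - dist1 (GaugeField.plaqHol (descendTo F ℰp (j + 1 + i) Ts h (Φ (V, z))) p)) / ((24 / 25 - 1 / 2) * θBal F.L γ b₀ p₀ (j + 1 + i))))) else 1))) * ρ' Ts (Φ (V, z)) * (J (V, z) : ℝ)) ∂τ)) ∂τ ≤ ηin Ts)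

end Summit.QuantumFields.YangMills.Cruxes.FluctuationComparisonRegPrIntL.SpreadFibreLawHDraft

end
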